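import Literature.AlgebraicGeometry.Resolution.AffinePointBlowupCharts
import Literature.AlgebraicGeometry.Resolution.CoordinateBlowupChart
import Literature.RingTheory.MvPolynomial.VariableIdeals
import HarnessLib

/-!
# Any blowing up of affine space `𝔸ⁿ⁺¹_K` along a COORDINATE SUBSPACE `V(xᵢ : i ∈ Λ)` is covered by `|Λ|` affine spaces
# `𝔸ⁿ⁺¹_K`, with EXPLICIT chart maps `xᵢ ↦ yᵢ`, `xⱼ ↦ yᵢ·yⱼ` (`j ∈ Λ ∖ {i}`), `xⱼ ↦ yⱼ` (`j ∉ Λ`) — EVERY `n`, EVERY `Λ`,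
# EVERY field `K`

Topic: `Literature/AlgebraicGeometry/Resolution`. Scheme-level library file (no named facts): the every-codimension form of
`AffinePointBlowupAlgebra.lean` / `AffinePointBlowupCharts.lean` (the case `Λ = univ`, centre = the origin). Let `K` be any field,
`P = 𝔸ⁿ⁺¹_K = Spec K[x₀, …, x_n]` (`AffinePointBlowup.P n K`), `Λ ⊆ {0, …, n}` a set of coordinates, `I_Λ = (xᵢ : i ∈ Λ)`,
`C_Λ = V(I_Λ) ⊆ P` the coordinate subspace (a closed irreducible subset), `𝓘_Λ` its reduced (vanishing) ideal sheaf.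

* `AffineCoordBlowup.CΛ`, `mem_CΛ_iff`, `ξ_mem_CΛ`, `isIrreducible_CΛ`; `AffineCoordBlowup.𝓘Λ = vanishingIdeal C_Λ` with
  **`ideal_𝓘Λ_top : 𝓘_Λ(⊤) = (xᵢ : i ∈ Λ)`** (`map_ideal_𝓘Λ_top`: under `γ : Γ(P, ⊤) ≅ K[x]` it is `I_Λ`), `𝓘Λ_ne_bot`;
  `𝓘Λ_univ : 𝓘_univ = 𝓘_{ξ}` and `CΛ_univ : C_univ = {ξ}` (the point case of `AffinePointBlowupAlgebra.lean`);
* the ring level is the tree's `CoordinateBlowupChart.lean` (Hu 2025 Prop. 5.3 / Görtz–Wedhorn (13.19), any `S`, `σ`, `Λ`):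
  `coordBlowupSubst K Λ i` (`xᵢ ↦ xᵢ`, `xⱼ ↦ xᵢ·xⱼ` for `j ∈ Λ ∖ {i}`, `xⱼ ↦ xⱼ` for `j ∉ Λ`) and
  `coordBlowupChartEquiv K Λ i : K[x] ≃ₐ[K] K[x][I_Λ/xᵢ]`; here `constantCoeff_coordBlowupSubst`, `specMap_coordBlowupSubst_ξ`
  (the substitution fixes the origin);
* for ANY blowing up `π : W → P` of `𝓘_Λ` (`IsBlowup`, universal property) and `i ∈ Λ`:
  `AffineCoordBlowup.chart Λ π i = W[⊤, xᵢ]` (principal chart), affine, **`⨆_{i ∈ Λ} W[⊤, xᵢ] = W`** (`iSup_chart`);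
  **`AffineCoordBlowup.chartImm hπ hi : P ⟶ W`** — an OPEN IMMERSION of `𝔸ⁿ⁺¹_K` onto `W[⊤, xᵢ]` (`opensRange_chartImm`;
  Stacks 0804 transported by `IsBlowup.exists_chart_of_ringEquiv`) with **`chartImm hπ hi ≫ π = Spec (coordBlowupSubst K Λ i)`**
  (`chartImm_comp`), hence `chartImm ≫ π ≫ f = f` over `Spec K` (`chartImm_comp_f`);
  `chartCover hπ hΛ : W.OpenCover` (for `Λ` nonempty), **`smooth_comp` — `W → Spec K` is SMOOTH** (every field `K`),
  `quasiCompact_comp`, `locallyOfFiniteType_comp`; `ξ' hπ hi`, `π_ξ'` — the chart origin lies over the origin `ξ ∈ C_Λ`;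
  `exists_chartEquiv` — sections form `Γ(W, W[⊤, xᵢ]) ≅ K[x]` with `π^* s ↦ coordBlowupSubst K Λ i (γ s)`.

These are the standard charts of `Bl_{V(x_Λ)} 𝔸ⁿ⁺¹` (Görtz–Wedhorn I (13.19), Example 13.95; Hu 2025 Def. 5.2 / Prop. 5.3), for an
ARBITRARY blowing up (not a chosen model), every `n`, every `Λ`, every `K`.

## Sources

* The Stacks Project, Tag 0804 (the blowing up is covered by the `Spec A[I/a]`), Tag 0BIQ, Tag 02ND, Tag 02NS, Tag 00MA. [StacksProject]
* U. Görtz, T. Wedhorn, *Algebraic Geometry I*, 2nd ed. (2020), (13.19), Example 13.95. [GortzWedhorn2020]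
* Y. Hu, *Universal characteristic-free resolution of singularities, I*, arXiv:2507.21400 (2025), §5 Def. 5.2, Prop. 5.3. [Hu2025]
* A. Grothendieck, EGA IV₄ (1967), Prop. 17.5.8 (iii) (smoothness is local; polynomial algebras are smooth). [Grothendieck1967]
* M. Atiyah, I. Macdonald, *Introduction to Commutative Algebra* (1969), Ch. 1 Ex. 19 (`V(𝔭)` is irreducible). [AtiyahMacdonald1969]
-/

noncomputable section

open CategoryTheory AlgebraicGeometry TopologicalSpace Opposite MvPolynomial
open Scheme.IdealSheafData

namespace Literature.AlgebraicGeometry.Resolution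

namespace AffineCoordBlowup

open AffinePointBlowup

universe u

variable (n : ℕ) (K : Type u) [Field K] (Λ : Set (Fin (n + 1)))

/-! ## The coordinate subspace `C_Λ = V(xᵢ : i ∈ Λ)` and its ideal sheaf -/

/-- The ideal `I_Λ = (xᵢ : i ∈ Λ)` of `K[x₀, …, x_n]`. [folklore] -/
abbrev IΛ : Ideal (A n K) := Ideal.span (X '' Λ)

/-- `I_Λ` is prime. [cite: AtiyahMacdonald1969, Ch. 1 Ex. 19] -/
theorem isPrime_IΛ : (IΛ n K Λ).IsPrime := Literature.RingTheory.MvPolynomial.isPrime_span_X_image Λ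

/-- **The coordinate subspace `C_Λ = V(xᵢ : i ∈ Λ) ⊆ 𝔸ⁿ⁺¹_K`** as a closed subset. [cite: AtiyahMacdonald1969, Ch. 1 Ex. 15] -/
def CΛ : Closeds (P n K) :=
  ⟨PrimeSpectrum.zeroLocus ((IΛ n K Λ : Ideal (A n K)) : Set (A n K)), PrimeSpectrum.isClosed_zeroLocus _⟩

/-- Points of `C_Λ`: the primes containing `I_Λ`. [cite: AtiyahMacdonald1969, Ch. 1 Ex. 15] -/
theorem mem_CΛ_iff (x : P n K) : x ∈ CΛ n K Λ ↔ IΛ n K Λ ≤ x.asIdeal :=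
  Iff.rfl

/-- Points of `C_Λ`: the primes containing every `xᵢ`, `i ∈ Λ`. [cite: AtiyahMacdonald1969, Ch. 1 Ex. 15] -/
theorem mem_CΛ_iff' (x : P n K) : x ∈ CΛ n K Λ ↔ ∀ i ∈ Λ, (X i : A n K) ∈ x.asIdeal := by
  rw [mem_CΛ_iff, Ideal.span_le, Set.image_subset_iff]
  rfl

/-- The origin lies on every coordinate subspace. [cite: AtiyahMacdonald1969, Ch. 1 Ex. 15] -/
theorem ξ_mem_CΛ : ξ n K ∈ CΛ n K Λ := by
  rw [mem_CΛ_iff']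
  intro i _
  change (X i : A n K) ∈ originIdeal K (n + 1)
  rw [mem_originIdeal_iff, constantCoeff_X]

/-- `C_Λ = V(𝔭)` for the prime `𝔭 = I_Λ`, hence irreducible. [cite: AtiyahMacdonald1969, Ch. 1 Ex. 19] -/
theorem isIrreducible_CΛ : IsIrreducible (CΛ n K Λ : Set (P n K)) := by
  have hprime : ((IΛ n K Λ).radical).IsPrime := by
    rw [(isPrime_IΛ n K Λ).radical]
    exact isPrime_IΛ n K Λ
  exact (PrimeSpectrum.isIrreducible_zeroLocus_iff (IΛ n K Λ)).mpr hprime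

/-- `C_Λ ≠ P` when `Λ` is nonempty (the generic point is not on it). [cite: AtiyahMacdonald1969, Ch. 1 Ex. 15] -/
theorem coe_CΛ_ne_univ (hΛ : Λ.Nonempty) : (CΛ n K Λ : Set (P n K)) ≠ Set.univ := by
  obtain ⟨i, hi⟩ := hΛ
  intro h
  have hη : (⟨⊥, Ideal.isPrime_bot⟩ : P n K) ∈ (CΛ n K Λ : Set (P n K)) := by
    rw [h]; exact Set.mem_univ _
  have hX := (mem_CΛ_iff' n K Λ _).mp hη i hi
  exact X_ne_zero i (Ideal.mem_bot.mp hX)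

/-- **The reduced ideal sheaf `𝓘_Λ = 𝓘_{C_Λ}`** of the coordinate subspace. [folklore] -/
def 𝓘Λ : (P n K).IdealSheafData := vanishingIdeal (CΛ n K Λ)

/-- The support of `𝓘_Λ` is `C_Λ`. [cite: StacksProject, Tag 01HR] -/
theorem support_𝓘Λ : (𝓘Λ n K Λ).support = CΛ n K Λ :=
  Closeds.ext (coe_support_vanishingIdeal (CΛ n K Λ))

/-- `γ⁻¹ I_Λ = (coord i : i ∈ Λ)` is prime in `Γ(P, ⊤)`. [cite: AtiyahMacdonald1969, Ch. 1 Ex. 19] -/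
theorem isPrime_map_symm_IΛ :
    ((IΛ n K Λ).map ((γ n K).symm : A n K →+* Γ(P n K, Wtop n K))).IsPrime := by
  haveI := isPrime_IΛ n K Λ
  exact Ideal.map_isPrime_of_equiv (γ n K).symm

/-- `γ⁻¹ I_Λ = (coord i : i ∈ Λ)`. [cite: StacksProject, Tag 01HR] -/
theorem map_symm_IΛ :
    (IΛ n K Λ).map ((γ n K).symm : A n K →+* Γ(P n K, Wtop n K)) = Ideal.span (coord n K '' Λ) := by
  rw [Ideal.map_span, Set.image_image]
  rfl

/-- **`𝓘_Λ(⊤) = (xᵢ : i ∈ Λ)`** (sections over the affine open `⊤`, as elements `coord i ∈ Γ(P, ⊤)`).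
[cite: StacksProject, Tag 01HR] -/
theorem ideal_𝓘Λ_top : (𝓘Λ n K Λ).ideal (Wtop n K) = Ideal.span (coord n K '' Λ) := by
  rw [𝓘Λ, vanishingIdeal_ideal, fromSpec_Wtop]
  change PrimeSpectrum.vanishingIdeal
    ((PrimeSpectrum.comap (Scheme.ΓSpecIso (.of (A n K))).inv.hom) ⁻¹'
      PrimeSpectrum.zeroLocus ((IΛ n K Λ : Ideal (A n K)) : Set (A n K))) = _
  rw [PrimeSpectrum.preimage_comap_zeroLocus, ← PrimeSpectrum.zeroLocus_span,
    PrimeSpectrum.vanishingIdeal_zeroLocus_eq_radical]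
  change ((IΛ n K Λ).map ((γ n K).symm : A n K →+* Γ(P n K, Wtop n K))).radical = _
  rw [(isPrime_map_symm_IΛ n K Λ).radical, map_symm_IΛ]

/-- Under `γ`, `𝓘_Λ(⊤)` is the ideal `I_Λ = (Xᵢ : i ∈ Λ)` of `K[x]`. [cite: StacksProject, Tag 01HR] -/
theorem map_ideal_𝓘Λ_top : ((𝓘Λ n K Λ).ideal (Wtop n K)).map (γ n K).toRingHom = IΛ n K Λ := by
  rw [ideal_𝓘Λ_top, Ideal.map_span, Set.image_image]
  congr 1
  exact Set.image_congr fun i _ => γ_coord n K i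

/-- `xᵢ ∈ 𝓘_Λ(⊤)` for `i ∈ Λ`. [cite: StacksProject, Tag 01HR] -/
theorem coord_mem_𝓘Λ {i : Fin (n + 1)} (hi : i ∈ Λ) : coord n K i ∈ (𝓘Λ n K Λ).ideal (Wtop n K) := by
  rw [ideal_𝓘Λ_top]
  exact Ideal.subset_span ⟨i, hi, rfl⟩

/-- `𝓘_Λ ≠ 0` for `Λ` nonempty. [cite: StacksProject, Tag 01HR] -/
theorem 𝓘Λ_ne_bot (hΛ : Λ.Nonempty) : 𝓘Λ n K Λ ≠ ⊥ := by
  obtain ⟨i, hi⟩ := hΛ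
  intro h
  have h1 : coord n K i ∈ (𝓘Λ n K Λ).ideal (Wtop n K) := coord_mem_𝓘Λ n K Λ hi
  rw [h, Scheme.IdealSheafData.ideal_bot] at h1
  exact coord_ne_zero n K i h1

/-- **The point case**: for `Λ = univ` the ideal sheaf is the ideal `𝓘_{ξ}` of the origin of `AffinePointBlowupAlgebra.lean`.
[cite: StacksProject, Tag 01HR] -/
theorem 𝓘Λ_univ : 𝓘Λ n K Set.univ = 𝓘 n K := by
  apply Scheme.IdealSheafData.ext_of_isAffine
  change (𝓘Λ n K Set.univ).ideal (Wtop n K) = (𝓘 n K).ideal (Wtop n K)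
  rw [ideal_𝓘Λ_top, ideal_𝓘_top, Set.image_univ]

/-- The point case on closed subsets: `C_univ = {ξ}`. [cite: StacksProject, Tag 01HR] -/
theorem CΛ_univ : CΛ n K Set.univ = C₀ n K := by
  rw [← support_𝓘Λ, 𝓘Λ_univ]
  exact Closeds.ext (coe_support_vanishingIdeal (C₀ n K))

/-! ## The chart substitution fixes the origin -/

section Algebra

variable (i : Fin (n + 1))

/-- `coordBlowupSubst K Λ i` preserves the constant coefficient. [cite: Hu2025, §5 Prop. 5.3] -/
theorem constantCoeff_coordBlowupSubst (a : A n K) :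
    constantCoeff (coordBlowupSubst K Λ i a) = constantCoeff a := by
  induction a using MvPolynomial.induction_on with
  | C c => rw [coordBlowupSubst_C]
  | add p q hp hq => simp only [map_add, hp, hq]
  | mul_X p j hp =>
    rw [map_mul, map_mul, hp, coordBlowupSubst_X]
    split_ifs <;> simp

/-- The substitution fixes the origin: `Spec (coordBlowupSubst K Λ i) (ξ) = ξ`. [cite: Hu2025, §5 Prop. 5.3] -/
theorem specMap_coordBlowupSubst_ξ :
    Spec.map (CommRingCat.ofHom (coordBlowupSubst K Λ i).toRingHom) (ξ n K) = ξ n K := by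
  apply PrimeSpectrum.ext
  ext a
  change coordBlowupSubst K Λ i a ∈ originIdeal K (n + 1) ↔ a ∈ originIdeal K (n + 1)
  rw [mem_originIdeal_iff, mem_originIdeal_iff, constantCoeff_coordBlowupSubst]

/-- The chart ring isomorphism `K[x] ≅ K[x][I_Λ/xᵢ]` of `CoordinateBlowupChart.lean`, as a ring isomorphism.
[cite: Hu2025, §5 Prop. 5.3] -/
def chartRingEquiv : A n K ≃+* blowupAlgebra (IΛ n K Λ) (X i : A n K) :=
  (coordBlowupChartEquiv K Λ i).toRingEquiv

/-- `chartRingEquiv⁻¹ (a/1) = coordBlowupSubst K Λ i a`. [cite: Hu2025, §5 Prop. 5.3] -/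
theorem chartRingEquiv_symm_algebraMap (a : A n K) :
    (chartRingEquiv n K Λ i).symm (algebraMap (A n K) (blowupAlgebra (IΛ n K Λ) (X i : A n K)) a) =
      coordBlowupSubst K Λ i a :=
  coordBlowupChartEquiv_symm_algebraMap K Λ i a

end Algebra

/-! ## The charts of a blowing up of `𝔸ⁿ⁺¹` along `C_Λ` -/

section Blowup

variable {n K}
variable {W : Scheme.{u}} (π : W ⟶ P n K)

/-- **The chart `W[⊤, xᵢ]`** of a morphism `π : W → P` for the ideal `𝓘_Λ` (the tree's principal chart of `π` for `(⊤, xᵢ)`).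
[cite: StacksProject, Tag 0804] -/
def chart (i : Fin (n + 1)) : W.Opens := blowupChart π (𝓘Λ n K Λ) (Wtop n K) (coord n K i)

/-- `W[⊤, xᵢ] ≤ π⁻¹(⊤)`. [cite: StacksProject, Tag 0804] -/
theorem chart_le (i : Fin (n + 1)) : chart Λ π i ≤ π ⁻¹ᵁ ((Wtop n K) : (P n K).Opens) :=
  blowupChart_le_preimage π (𝓘Λ n K Λ) (Wtop n K) (coord n K i)

variable {Λ π} (hπ : IsBlowup π (𝓘Λ n K Λ))
include hπ

/-- The charts of a blowing up at the centre variables are affine. [cite: StacksProject, Tag 0804] -/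
theorem isAffineOpen_chart {i : Fin (n + 1)} (hi : i ∈ Λ) : IsAffineOpen (chart Λ π i) :=
  hπ.isAffineOpen_blowupChart (coord_mem_𝓘Λ n K Λ hi)

/-- **The `|Λ|` charts cover the blow-up.** [cite: StacksProject, Tag 0804] -/
theorem iSup_chart : ⨆ i : Λ, chart Λ π (i : Fin (n + 1)) = ⊤ := by
  have h := hπ.iSup_blowupChart (fun i : Λ => coord n K (i : Fin (n + 1)))
    (by rw [← Set.image_eq_range]; exact (ideal_𝓘Λ_top n K Λ).symm)
  change ⨆ i : Λ, blowupChart π (𝓘Λ n K Λ) (Wtop n K) (coord n K (i : Fin (n + 1))) = ⊤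
  rw [h]
  exact π.preimage_top

/-- The raw `i`-th chart `Spec K[x][I_Λ/xᵢ] → W` (Stacks 0804, transported along `γ : Γ(P, ⊤) ≅ K[x]`).
[cite: StacksProject, Tag 0804] -/
theorem exists_rawChart {i : Fin (n + 1)} (hi : i ∈ Λ) :
    ∃ (c : Spec (.of (blowupAlgebra (IΛ n K Λ) (X i : A n K))) ⟶ W) (_ : IsOpenImmersion c),
      c.opensRange = chart Λ π i ∧
        c ≫ π = Spec.map (CommRingCat.ofHom ((algebraMap (A n K) (blowupAlgebra (IΛ n K Λ) (X i : A n K))).comp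
          (γ n K).toRingHom)) ≫ (Wtop n K).2.fromSpec :=
  hπ.exists_chart_of_ringEquiv (Wtop n K) (coord_mem_𝓘Λ n K Λ hi) (γ n K) (IΛ n K Λ) (X i)
    (map_ideal_𝓘Λ_top n K Λ) (γ_coord n K i)

/-- **The `i`-th chart `chartImm hπ hi : 𝔸ⁿ⁺¹_K ⟶ W`** (`i ∈ Λ`) of a blowing up of `𝔸ⁿ⁺¹_K` along `C_Λ`. [cite: StacksProject, Tag 0804] -/
def chartImm {i : Fin (n + 1)} (hi : i ∈ Λ) : P n K ⟶ W :=
  Spec.map (chartRingEquiv n K Λ i).symm.toCommRingCatIso.hom ≫ (exists_rawChart hπ hi).choose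

/-- The chart is an open immersion. [cite: StacksProject, Tag 0804] -/
instance isOpenImmersion_chartImm {i : Fin (n + 1)} (hi : i ∈ Λ) : IsOpenImmersion (chartImm hπ hi) := by
  haveI := (exists_rawChart hπ hi).choose_spec.choose
  exact inferInstanceAs
    (IsOpenImmersion (Spec.map (chartRingEquiv n K Λ i).symm.toCommRingCatIso.hom ≫ (exists_rawChart hπ hi).choose))

/-- **The image of the `i`-th chart is the principal chart `W[⊤, xᵢ]`.** [cite: StacksProject, Tag 0804] -/
theorem opensRange_chartImm {i : Fin (n + 1)} (hi : i ∈ Λ) : (chartImm hπ hi).opensRange = chart Λ π i := by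
  haveI := (exists_rawChart hπ hi).choose_spec.choose
  change (Spec.map (chartRingEquiv n K Λ i).symm.toCommRingCatIso.hom ≫ (exists_rawChart hπ hi).choose).opensRange = _
  rw [Scheme.Hom.opensRange_comp_of_isIso]
  exact (exists_rawChart hπ hi).choose_spec.choose_spec.1

/-- **The chart map in coordinates: `chartImm hπ hi ≫ π = Spec (coordBlowupSubst K Λ i)`**, i.e. on the `i`-th chart `π` is
`xᵢ ↦ yᵢ`, `xⱼ ↦ yᵢ·yⱼ` (`j ∈ Λ ∖ {i}`), `xⱼ ↦ yⱼ` (`j ∉ Λ`). [cite: Hu2025, §5 Prop. 5.3] -/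
theorem chartImm_comp {i : Fin (n + 1)} (hi : i ∈ Λ) :
    chartImm hπ hi ≫ π = Spec.map (CommRingCat.ofHom (coordBlowupSubst K Λ i).toRingHom) := by
  change (Spec.map (chartRingEquiv n K Λ i).symm.toCommRingCatIso.hom ≫ (exists_rawChart hπ hi).choose) ≫ π = _
  rw [Category.assoc, (exists_rawChart hπ hi).choose_spec.choose_spec.2, specMap_comp_γ_fromSpec,
    ← Spec.map_comp]
  congr 1
  apply CommRingCat.hom_ext
  refine RingHom.ext fun a => ?_
  change (chartRingEquiv n K Λ i).symm (algebraMap (A n K) (blowupAlgebra (IΛ n K Λ) (X i : A n K)) a) =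
    coordBlowupSubst K Λ i a
  exact chartRingEquiv_symm_algebraMap n K Λ i a

/-- **Over `Spec K` the chart is the identity of `𝔸ⁿ⁺¹_K`:** `chartImm hπ hi ≫ π ≫ f = f`. [cite: Hu2025, §5 Prop. 5.3] -/
theorem chartImm_comp_f {i : Fin (n + 1)} (hi : i ∈ Λ) : chartImm hπ hi ≫ π ≫ f n K = f n K := by
  rw [← Category.assoc, chartImm_comp, f, ← Spec.map_comp]
  congr 1
  apply CommRingCat.hom_ext
  refine RingHom.ext fun c => ?_
  change coordBlowupSubst K Λ i (algebraMap K (A n K) c) = algebraMap K (A n K) c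
  exact (coordBlowupSubst K Λ i).commutes c

/-- The images of the charts cover `W`. [cite: StacksProject, Tag 0804] -/
theorem iSup_opensRange_chartImm : ⨆ i : Λ, (chartImm hπ i.2).opensRange = ⊤ := by
  simp_rw [opensRange_chartImm]
  exact iSup_chart hπ

/-- Every point of `W` lies in the image of some chart `i ∈ Λ`. [cite: StacksProject, Tag 0804] -/
theorem exists_mem_opensRange_chartImm (w : W) : ∃ i : Λ, w ∈ (chartImm hπ i.2).opensRange := by
  have hw : w ∈ (⊤ : W.Opens) := trivial
  rw [← iSup_opensRange_chartImm hπ, Opens.mem_iSup] at hw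
  exact hw

/-- **The open cover of `W` by `|Λ|` affine spaces `𝔸ⁿ⁺¹_K`.** [cite: StacksProject, Tag 0804] -/
def chartCover : Scheme.OpenCover.{0} W :=
  Scheme.Cover.mkOfCovers (↥Λ) (fun _ => P n K) (fun i => chartImm hπ i.2) fun w => by
    obtain ⟨i, y, hy⟩ := exists_mem_opensRange_chartImm hπ w
    exact ⟨i, y, hy⟩

omit hπ in
/-- **A blow-up of `𝔸ⁿ⁺¹_K` along the coordinate subspace `C_Λ` is SMOOTH over `K` — every field `K`, every `Λ`.**
[cite: Grothendieck1967, Prop. 17.5.8 (iii) (PDF p. 69)] -/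
theorem smooth_comp (hπ : IsBlowup π (𝓘Λ n K Λ)) : Smooth (π ≫ f n K) :=
  (IsZariskiLocalAtSource.iff_of_openCover (P := @Smooth) (chartCover hπ)).mpr fun i => by
    change Smooth (chartImm hπ i.2 ≫ π ≫ f n K)
    rw [chartImm_comp_f]
    exact smooth_f n K

omit hπ in
/-- For a blow-up of `𝔸ⁿ⁺¹_K` along `C_Λ`, `W → Spec K` is quasi-compact. [cite: StacksProject, Tag 02NS] -/
theorem quasiCompact_comp (hπ : IsBlowup π (𝓘Λ n K Λ)) : QuasiCompact (π ≫ f n K) := by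
  haveI : IsProper π := hπ.isProper
  infer_instance

omit hπ in
/-- For a blow-up of `𝔸ⁿ⁺¹_K` along `C_Λ`, `W → Spec K` is locally of finite type. [cite: StacksProject, Tag 02NS] -/
theorem locallyOfFiniteType_comp (hπ : IsBlowup π (𝓘Λ n K Λ)) : LocallyOfFiniteType (π ≫ f n K) := by
  haveI := smooth_comp hπ
  infer_instance

/-- The origin `ξ′ᵢ` of the `i`-th chart, a point of `W`. [cite: Hu2025, §5 Prop. 5.3] -/
def ξ' {i : Fin (n + 1)} (hi : i ∈ Λ) : W := chartImm hπ hi (ξ n K)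

/-- `ξ′ᵢ` lies in the `i`-th chart. [cite: StacksProject, Tag 0804] -/
theorem ξ'_mem {i : Fin (n + 1)} (hi : i ∈ Λ) : ξ' hπ hi ∈ chart Λ π i := by
  rw [← opensRange_chartImm hπ hi]
  exact ⟨ξ n K, rfl⟩

/-- **The chart origins lie over the origin: `π ξ′ᵢ = ξ`** (a point of the centre `C_Λ`). [cite: Hu2025, §5 Prop. 5.3] -/
theorem π_ξ' {i : Fin (n + 1)} (hi : i ∈ Λ) : π (ξ' hπ hi) = ξ n K := by
  change π (chartImm hπ hi (ξ n K)) = ξ n K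
  rw [← Scheme.Hom.comp_apply, chartImm_comp]
  exact specMap_coordBlowupSubst_ξ n K Λ i

omit hπ in
/-- Transport helper (dependent types): a sections isomorphism `Γ(W, W[⊤, xᵢ]) ≅ K[x][J/a]` for any `(J, a)` equal to
`(γ 𝓘_Λ(⊤), γ xᵢ)`. [cite: StacksProject, Tag 0804] -/
theorem exists_chartEquiv_aux (hπ : IsBlowup π (𝓘Λ n K Λ)) {i : Fin (n + 1)} (hi : i ∈ Λ) (J : Ideal (A n K)) (a : A n K)
    (hJ : ((𝓘Λ n K Λ).ideal (Wtop n K)).map (γ n K).toRingHom = J) (ha : γ n K (coord n K i) = a) :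
    ∃ Φ : Γ(W, chart Λ π i) ≃+* blowupAlgebra J a,
      ∀ s, Φ ((π.appLE (Wtop n K) (chart Λ π i) (chart_le Λ π i)).hom s) =
        algebraMap (A n K) (blowupAlgebra J a) (γ n K s) := by
  subst hJ
  subst ha
  obtain ⟨e, he⟩ := hπ.exists_ringEquiv_blowupChart (Wtop n K) (coord_mem_𝓘Λ n K Λ hi)
  refine ⟨e.trans (blowupAlgebra.congrEquiv (γ n K) ((𝓘Λ n K Λ).ideal (Wtop n K)) (coord n K i)), fun s => ?_⟩
  exact (congrArg (blowupAlgebra.congrEquiv (γ n K) ((𝓘Λ n K Λ).ideal (Wtop n K)) (coord n K i)) (he s)).trans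
    (blowupAlgebra.congrEquiv_algebraMap (γ n K) _ _ s)

/-- **Each chart is an affine space, in sections**: `Γ(W, W[⊤, xᵢ]) ≅ K[x₀, …, x_n]` with
`π^* s ↦ coordBlowupSubst K Λ i (γ s)`. [cite: StacksProject, Tag 0BIQ] -/
theorem exists_chartEquiv {i : Fin (n + 1)} (hi : i ∈ Λ) :
    ∃ Φ : Γ(W, chart Λ π i) ≃+* A n K,
      ∀ s, Φ ((π.appLE (Wtop n K) (chart Λ π i) (chart_le Λ π i)).hom s) = coordBlowupSubst K Λ i (γ n K s) := by
  obtain ⟨Φ₀, hΦ₀⟩ := exists_chartEquiv_aux hπ hi (IΛ n K Λ) (X i) (map_ideal_𝓘Λ_top n K Λ) (γ_coord n K i)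
  refine ⟨Φ₀.trans (chartRingEquiv n K Λ i).symm, fun s => ?_⟩
  exact (congrArg (chartRingEquiv n K Λ i).symm (hΦ₀ s)).trans (chartRingEquiv_symm_algebraMap n K Λ i _)

end Blowup

end AffineCoordBlowup

end Literature.AlgebraicGeometry.Resolution

end
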